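import Summits.BirchSwinnertonDyer.BirchSwinnertonDyer.Theorems.PrintCFramBottomClassIndexLawFiveLeNoAdmissiblePrimes
import Summits.BirchSwinnertonDyer.BirchSwinnertonDyer.Theorems.AdditiveRankOneBSDpOfExactIndexManin
import Summits.BirchSwinnertonDyer.Rank1Residual.X11b.BDPRouteOnTreeStepL
import Literature.NumberTheory.EllipticCurves.Kim2024.DefiniteSelmerStructure
import HarnessLib

/-!
# Crux `PrintCFram.BottomClassIndexLawFiveLe` (stmt-BirchSwinnertonDyer-20372): the published line `bipartite_toric_borel`
# is DEAD BY VACUITY — its S2 holds vacuously and its S3 is false at every frame (no admissible primes on the class)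

Cell `bsd-print-cfram`, LEAD seat `bsd-line-cfram-p1` (generation g15); helper `--supports stmt-BirchSwinnertonDyer-20372`.
THEOREMS ONLY: no definition, no named fact, no `sorry`. BSD is not proved by any of this; no summit statement is proved by
this seat; the crux is NOT claimed false; nothing of the line of record (`eisenstein_resource_bdp_line`, registry v32) is touched.

The companion file `…NoAdmissiblePrimes` proves that a member `W` of the CM-ramified class (`W/ℚ` globally minimal with CM,
`p ≥ 5` CM-ramified) has NO Bertolini–Darmon `1`-admissible prime: for `q ∤ p·N_W`, «`p ∤ q² − 1` ∧ `a_q(W) ≡ ±(q+1) (mod p)`» is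
impossible (`no_admissible_level`: no square-free `n` with an odd number of admissible prime factors). The two research stubs of the
published (never registered) line `Lines/bipartite_toric_borel.lean` (ideator bsd-idea-7 g16; critic V#136 PASS-WITH-PRICE) quantify
over exactly such a «definite unit datum» `(n, Sₙ, ψₙ, fₙ)`:

* `bipartiteLower_borelCM_vacuous` — the TEXT of S2 `stub_bipartiteLower_borelCM` VERBATIM, PROVED: its hypotheses contain an
  admissible level `n`, which does not exist, so the implication holds vacuously (it carries no information about the index).
* `companionPeriodUnit_borelCM_false_of_frame` — the TEXT of S3 `stub_companionPeriodUnit_borelCM` (as hypothesis) implies `False`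
  at EVERY member and frame: S3 asserts the EXISTENCE of an admissible level. Hence S3 is false as soon as one member of the class
  admits one Heegner frame (the shared S1 of the two Kolyvagin-type lines supplies frames from modularity + Hoffstein–Luo).

So the composition `bsdp_of_hyps` of that line can never be fed: road II-bis (bipartite Euler systems / level raising at admissible
primes — Bertolini–Darmon 2005, W. Zhang 2014, Kim 2024) is not available for the B1 residue of this crux. The LEAD's dossier
(crux notes lead-g15) records the consequence: road II = Kolyvagin's UPPER inequality at the Borel prime (Kolyvagin primes
`q ≡ −1 (mod p)` DO exist) + Kolyvagin's conjecture with no known mechanism; road I = the ramified `p`-adic Gross–Zagier formula.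

References: Bertolini–Darmon, Ann. of Math. 162 (2005) §2.2; C.-H. Kim, Trans. AMS 377 (2024) §2.4, Thm. 4.22–4.26; W. Zhang,
Camb. J. Math. 2 (2014) §3; Cox, *Primes of the form x² + ny²*, Thm. 14.16 (Deuring).
-/

set_option autoImplicit false
-- `…BirchSwinnertonDyer.BirchSwinnertonDyer.Theorems…` is the problem's mandated namespace (D-0017).
set_option linter.dupNamespace false

noncomputable section

open scoped Classical Matrix
open NumberField IsDedekindDomain Field WeierstrassCurve
open Literature.NumberTheory.Automorphic
open Literature.NumberTheory.EllipticCurves Literature.NumberTheory.EllipticCurves.ModularForms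
open Literature.NumberTheory.EllipticCurves.Rank1Residual
open Summit.BirchSwinnertonDyer.Rank1Residual
open Summit.BirchSwinnertonDyer.BirchSwinnertonDyer.Theorems.SchneiderFree

namespace Summit.BirchSwinnertonDyer.BirchSwinnertonDyer.Theorems.PrintCFram.NoAdmissiblePrimes

/-- **S2 of `bipartite_toric_borel` (`stub_bipartiteLower_borelCM`, text VERBATIM) holds VACUOUSLY**: among its hypotheses is a
square-free `n` with an odd number of prime factors, each `1`-admissible for `(W, K'', p)`; by `no_admissible_level` no such `n`
exists for a member of the CM-ramified class, so the stated implication (to `IndexLowerBoundLeAt`) is true and EMPTY.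
[cite: BertoliniDarmon2005, §2.2] [cite: Kim2024, Thm. 4.24, Thm. 4.26, §2.4 (arXiv:2203.12161v7)] -/
theorem bipartiteLower_borelCM_vacuous :
    ∀ (W : WeierstrassCurve ℚ) [W.IsElliptic] [W.IsGloballyMinimal] (p : ℕ) [Fact p.Prime],
      W.HasCM → CMRamified W p → 5 ≤ p → W.analyticRank = 1 →
      ∀ (N : ℕ) [NeZero N] (K : Type) [Field K] [NumberField K]
        (Dt : ModularParametrizationData W N) (H : HeegnerDatum N (NumberField.discr K)) (ι : K →+* ℂ)
        (P : (W.baseChange K).toAffine.Point),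
        W.conductorNorm ℤ = N → IsImaginaryQuadratic K → Odd (NumberField.discr K) →
        ¬ p ∣ Units.torsionOrder K → SatisfiesHeegnerHypothesis N K →
        (W.quadraticTwist (NumberField.discr K : ℚ)).entireLFunction 1 ≠ 0 →
        WeierstrassCurve.Affine.Point.map ι.toRatAlgHom P = heegnerPointComplex Dt H →
        ¬ IsOfFinAddOrder P →
        ∀ (n : ℕ) (Sₙ : Brandt.XiSetup N n) [Fintype (Brandt.ClassSet Sₙ.O)]
          (ψₙ : K →ₐ[ℚ] Sₙ.D) (fₙ : Brandt.ClassSet Sₙ.O → ZMod p),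
          Brandt.IsGrossPoint Sₙ.O ψₙ Sₙ.O →
          Squarefree n → Odd n.primeFactors.card →
          (∀ q ∈ n.primeFactors, ¬ q ∣ N * p ∧
            (((Ideal.span {(q : ℤ)}).primesOver (𝓞 K)).ncard ≠ 2 ∧ ¬ (q : ℤ) ∣ NumberField.discr K) ∧
            ¬ (p : ℤ) ∣ (q : ℤ) ^ 2 - 1 ∧
            ((p : ℤ) ∣ W.LFunction q - (q + 1) ∨ (p : ℤ) ∣ W.LFunction q + (q + 1))) →
          fₙ ≠ 0 →
          (∀ q : ℕ, q.Prime → ¬ q ∣ N * n * p →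
            fₙ ᵥ* (Brandt.matrix Sₙ.O q).map (Int.cast : ℤ → ZMod p) = ((W.LFunction q : ℤ) : ZMod p) • fₙ) →
          (∀ g : Brandt.ClassSet Sₙ.O → ZMod p,
            (∀ q : ℕ, q.Prime → ¬ q ∣ N * n * p →
              g ᵥ* (Brandt.matrix Sₙ.O q).map (Int.cast : ℤ → ZMod p) = ((W.LFunction q : ℤ) : ZMod p) • g) →
            ∃ c : ZMod p, g = c • fₙ) →
          Brandt.toricPeriod Sₙ.O ψₙ Sₙ.O fₙ ≠ 0 →
          IndexLowerBoundLeAt W p K P (padicValNat p Dt.c.natAbs) := by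
  intro W _ _ p _ hCM hram h5 _ N _ K _ _ Dt H ι P hN _ _ _ _ _ _ _ n Sₙ _ ψₙ fₙ _ _ hodd hadm _ _ _ _
  exact (no_admissible_level W p hCM hram h5 hN
    (fun q ↦ ((Ideal.span {(q : ℤ)}).primesOver (𝓞 K)).ncard ≠ 2 ∧ ¬ (q : ℤ) ∣ NumberField.discr K) n hodd hadm).elim

/-- **S3 of `bipartite_toric_borel` (`stub_companionPeriodUnit_borelCM`, text VERBATIM as the hypothesis `hS3`) is FALSE at every
member and frame**: it asserts, for every member `W` and every Heegner frame `(N, K'', Dt, H, ι, P)`, the EXISTENCE of an admissible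
level `n` (odd number of prime factors, each `1`-admissible) carrying a unit toric period — and no admissible level exists
(`no_admissible_level`). So `hS3` yields `False` from any member with any frame; the line's load-bearing stub cannot hold
non-vacuously. [cite: BertoliniDarmon2005, §2.2] [cite: Kim2024, Thm. 4.22 and §4.2.3 (arXiv:2203.12161v7)] -/
theorem companionPeriodUnit_borelCM_false_of_frame
    (hS3 : ∀ (W : WeierstrassCurve ℚ) [W.IsElliptic] [W.IsGloballyMinimal] (p : ℕ) [Fact p.Prime],
      W.HasCM → CMRamified W p → 5 ≤ p → W.analyticRank = 1 →
      ∀ (N : ℕ) [NeZero N] (K : Type) [Field K] [NumberField K]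
        (Dt : ModularParametrizationData W N) (H : HeegnerDatum N (NumberField.discr K)) (ι : K →+* ℂ)
        (P : (W.baseChange K).toAffine.Point),
        W.conductorNorm ℤ = N → IsImaginaryQuadratic K → Odd (NumberField.discr K) →
        ¬ p ∣ Units.torsionOrder K → SatisfiesHeegnerHypothesis N K →
        (W.quadraticTwist (NumberField.discr K : ℚ)).entireLFunction 1 ≠ 0 →
        WeierstrassCurve.Affine.Point.map ι.toRatAlgHom P = heegnerPointComplex Dt H →
        ¬ IsOfFinAddOrder P →
        ∃ (n : ℕ) (Sₙ : Brandt.XiSetup N n) (_ : Fintype (Brandt.ClassSet Sₙ.O))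
          (ψₙ : K →ₐ[ℚ] Sₙ.D) (fₙ : Brandt.ClassSet Sₙ.O → ZMod p),
          Brandt.IsGrossPoint Sₙ.O ψₙ Sₙ.O ∧
          Squarefree n ∧ Odd n.primeFactors.card ∧
          (∀ q ∈ n.primeFactors, ¬ q ∣ N * p ∧
            (((Ideal.span {(q : ℤ)}).primesOver (𝓞 K)).ncard ≠ 2 ∧ ¬ (q : ℤ) ∣ NumberField.discr K) ∧
            ¬ (p : ℤ) ∣ (q : ℤ) ^ 2 - 1 ∧
            ((p : ℤ) ∣ W.LFunction q - (q + 1) ∨ (p : ℤ) ∣ W.LFunction q + (q + 1))) ∧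
          fₙ ≠ 0 ∧
          (∀ q : ℕ, q.Prime → ¬ q ∣ N * n * p →
            fₙ ᵥ* (Brandt.matrix Sₙ.O q).map (Int.cast : ℤ → ZMod p) = ((W.LFunction q : ℤ) : ZMod p) • fₙ) ∧
          (∀ g : Brandt.ClassSet Sₙ.O → ZMod p,
            (∀ q : ℕ, q.Prime → ¬ q ∣ N * n * p →
              g ᵥ* (Brandt.matrix Sₙ.O q).map (Int.cast : ℤ → ZMod p) = ((W.LFunction q : ℤ) : ZMod p) • g) →
            ∃ c : ZMod p, g = c • fₙ) ∧
          Brandt.toricPeriod Sₙ.O ψₙ Sₙ.O fₙ ≠ 0) :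
    ∀ (W : WeierstrassCurve ℚ) [W.IsElliptic] [W.IsGloballyMinimal] (p : ℕ) [Fact p.Prime],
      W.HasCM → CMRamified W p → 5 ≤ p → W.analyticRank = 1 →
      ∀ (N : ℕ) [NeZero N] (K : Type) [Field K] [NumberField K]
        (Dt : ModularParametrizationData W N) (H : HeegnerDatum N (NumberField.discr K)) (ι : K →+* ℂ)
        (P : (W.baseChange K).toAffine.Point),
        W.conductorNorm ℤ = N → IsImaginaryQuadratic K → Odd (NumberField.discr K) →
        ¬ p ∣ Units.torsionOrder K → SatisfiesHeegnerHypothesis N K →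
        (W.quadraticTwist (NumberField.discr K : ℚ)).entireLFunction 1 ≠ 0 →
        WeierstrassCurve.Affine.Point.map ι.toRatAlgHom P = heegnerPointComplex Dt H →
        ¬ IsOfFinAddOrder P → False := by
  intro W _ _ p _ hCM hram h5 hr N _ K _ _ Dt H ι P hN hK hodd hunit hH hL hP hnt
  obtain ⟨n, Sₙ, _, ψₙ, fₙ, -, -, hoddn, hadm, -⟩ :=
    hS3 W p hCM hram h5 hr N K Dt H ι P hN hK hodd hunit hH hL hP hnt
  exact no_admissible_level W p hCM hram h5 hN
    (fun q ↦ ((Ideal.span {(q : ℤ)}).primesOver (𝓞 K)).ncard ≠ 2 ∧ ¬ (q : ℤ) ∣ NumberField.discr K) n hoddn hadm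

end Summit.BirchSwinnertonDyer.BirchSwinnertonDyer.Theorems.PrintCFram.NoAdmissiblePrimes

end
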